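import Literature.Probability.RandomPlanarGeometry.HexSAWStripWidthThreeEnclosure
import HarnessLib

/-!
# Width two versus width three at criticality: the surface-contact density and the renewal-point density both DROP, and a long
# critical width-three bridge touches the surface on fewer than a third of its steps (module «WIDTH-THREE-COMPARE»)

Topic `Literature/Probability/RandomPlanarGeometry` (continues «WIDTH-THREE-ENCLOSURE» `HexSAWStripWidthThreeEnclosure.lean` — `W3.thetaThree_window`,
`W3.nuThree_window`, `W3.sqrt_two_window15` — and compares with the width-two constants of the tree: «WIDTH-TWO-KERNEL» #715
`HexSAWStripWidthTwoKernel.lean` (`HV.widthTwo_pieces_per_step`: `ν₂ = √2 − 1/2`; `W2.contact_scalar_two`) and «CONTACT-LLN» #750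
`HexSAWStripBridgeContactLLN.lean` (`HV.widthTwo_contacts_deviation`: `θ₂ = (3 − √2)/4`)).  Lane «pcv-sawmu» (CriticalPhenomena venture), a-p2 g26.
The width-`T` renewal theory of the lane produces, for every `T ≥ 2`, a contact density `θ_T` (surface contacts per step of a long critical bridge /
β-walk of `S_T` at `(x_c, y_T)`) and a renewal-point density `ν_T` (irreducible pieces per step).  At `T = 2` they are `(3 − √2)/4 = 0.39644…` and
`√2 − 1/2 = 0.91421…` (closed forms, #687/#715/#750); at `T = 3` they are the sextic algebraic numbers `θ₃ = 0.330370770…`, `ν₃ = 0.82498467…`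
(«WIDTH-THREE-SEXTIC» / «WIDTH-THREE-ENCLOSURE»).  This file records the resulting ORDER facts.  Sources of the SETTING: N. R. Beaton, M. Bousquet-Mélou,
J. de Gier, H. Duminil-Copin, A. J. Guttmann, CMP 326 (2014) §3.2 and Corollary 8 (the strips `S_T`, `y_T` decreasing to `1 + √2`); H. Duminil-Copin,
A. Hammond, CMP 324 (2013) §2.2 (renewal structure); W. Feller I (1968) XIII.11.  Nothing below is printed; no monotonicity in `T` beyond `T ∈ {2, 3}`
is claimed.

## What is proved (namespace `Literature.Probability.RandomPlanarGeometry.SAW.HV.W3`)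

* ★★ **`thetaThree_lt_thetaTwo : thetaThree < (3 − √2)/4`** — widening the strip from two to three cells LOWERS the surface-contact density of long
  critical bridges (0.3304 < 0.3964); ★★ **`nuThree_lt_nuTwo : nuThree < √2 − 1/2`** — and lowers the density of renewal (irreducible-bridge) vertices
  (0.8250 < 0.9142), i.e. the mean irreducible piece is LONGER: `steps_per_piece_three_window : 1.21214 < 1/ν₃ < 1.21215` versus `(2 + 4√2)/7 = 1.0938…`
  (`steps_per_piece_two_lt_three`).
* ★★ **`thetaThree_lt_third : thetaThree < 1/3`** and `third_lt_thetaTwo : 1/3 < (3 − √2)/4` — at width three a long critical bridge touches the surface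
  on FEWER than a third of its steps, at width two on MORE.
* ★ `contacts_per_piece_three_window : 0.40045 < θ₃/ν₃ < 0.40047` and `contacts_per_piece_three_lt_two : thetaThree / nuThree < (5√2 − 1)/14` — the
  mean number of surface contacts per irreducible piece also drops (0.40046 < 0.43365 = `θ₂/ν₂`, #715 §8).

Label: LANE THEOREM (own result of lane «pcv-sawmu», a-p2 g26, 2026-08-27; not in print).  NOT claimed: `θ_T`, `ν_T` monotone in `T`; `T ≥ 4`.
-/

noncomputable section

open Finset Filter Topology Matrix Literature.Probability.LatticeModels Literature.Probability.Percolation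

namespace Literature.Probability.RandomPlanarGeometry.SAW

namespace HV

namespace W3

/-- ★★ **The contact density drops from width two to width three: `θ₃ < θ₂ = (3 − √2)/4`** (`0.3303707… < 0.3964466…`; `θ₂` is the constant of
#750 `HV.widthTwo_contacts_deviation`, `θ₃` that of `W3.widthThree_contacts_deviation_explicit`).
[cite: BeatonBousquetMelouDeGierDuminilCopinGuttmann2014, §3.2 and Corollary 8; Feller1968, XIII.11; lane «pcv-sawmu» a-p2 g26 — own result, not in print] -/
theorem thetaThree_lt_thetaTwo : thetaThree < (3 - Real.sqrt 2) / 4 := by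
  obtain ⟨-, h⟩ := thetaThree_window
  obtain ⟨-, hr⟩ := sqrt_two_window15
  linarith

/-- ★★ **The renewal-point density drops from width two to width three: `ν₃ < ν₂ = √2 − 1/2`** (`0.8249846… < 0.9142135…`; `ν₂` is the constant of
#715 `HV.widthTwo_pieces_per_step`, `ν₃` that of `W3.widthThree_pieces_deviation_explicit`).
[cite: DuminilCopinHammond2013, §2.2; Feller1968, XIII.3 and XIII.11; lane «pcv-sawmu» a-p2 g26 — own result, not in print] -/
theorem nuThree_lt_nuTwo : nuThree < Real.sqrt 2 - 1 / 2 := by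
  obtain ⟨-, h⟩ := nuThree_window
  obtain ⟨hr, -⟩ := sqrt_two_window15
  linarith

/-- ★★ **At width three a long critical bridge touches the surface on fewer than a third of its steps: `θ₃ < 1/3`.**
[cite: BeatonBousquetMelouDeGierDuminilCopinGuttmann2014, Corollary 8; Feller1968, XIII.11; lane «pcv-sawmu» a-p2 g26 — own result, not in print] -/
theorem thetaThree_lt_third : thetaThree < 1 / 3 := by
  obtain ⟨-, h⟩ := thetaThree_window
  linarith

/-- … whereas at width two it does so on more than a third of its steps: `1/3 < θ₂ = (3 − √2)/4`. [cite: BeatonBousquetMelouDeGierDuminilCopinGuttmann2014, Corollary 8; lane «pcv-sawmu» a-p2 g26] -/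
theorem third_lt_thetaTwo : (1 : ℝ) / 3 < (3 - Real.sqrt 2) / 4 := by
  obtain ⟨-, hr⟩ := sqrt_two_window15
  linarith

/-- The mean length of an irreducible piece of a long critical width-three bridge, `1/ν₃`, to five decimals: `1.21214 < 1/ν₃ < 1.21215`.
[cite: Feller1968, XIII.3 (renewal density = 1/mean recurrence time); DuminilCopinHammond2013, §2.2; lane «pcv-sawmu» a-p2 g26 — own result] -/
theorem steps_per_piece_three_window : (1.21214 : ℝ) < 1 / nuThree ∧ 1 / nuThree < (1.21215 : ℝ) := by
  obtain ⟨h1, h2⟩ := nuThree_window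
  have hpos : 0 < nuThree := lt_trans (by norm_num) h1
  constructor
  · rw [lt_div_iff₀ hpos]; nlinarith
  · rw [div_lt_iff₀ hpos]; nlinarith

/-- ★ **Irreducible pieces get longer from width two to width three**: `1/ν₂ = (2 + 4√2)/7 = 1.0938… < 1.2121… = 1/ν₃`.
[cite: DuminilCopinHammond2013, §2.2; Feller1968, XIII.3; lane «pcv-sawmu» a-p2 g26 — own result, not in print] -/
theorem steps_per_piece_two_lt_three : (2 + 4 * Real.sqrt 2) / 7 < 1 / nuThree := by
  obtain ⟨h1, -⟩ := steps_per_piece_three_window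
  obtain ⟨-, hr⟩ := sqrt_two_window15
  linarith

/-- ★ **Surface contacts per irreducible piece at width three, `θ₃/ν₃`, to five decimals: `0.40045 < θ₃/ν₃ < 0.40047`.**
[cite: Feller1968, XIII.11 (renewal–reward ratio); DuminilCopinHammond2013, §2.2; lane «pcv-sawmu» a-p2 g26 — own result] -/
theorem contacts_per_piece_three_window : (0.40045 : ℝ) < thetaThree / nuThree ∧ thetaThree / nuThree < (0.40047 : ℝ) := by
  obtain ⟨h1, h2⟩ := nuThree_window
  obtain ⟨h3, h4⟩ := thetaThree_window
  have hpos : 0 < nuThree := lt_trans (by norm_num) h1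
  constructor
  · rw [lt_div_iff₀ hpos]; nlinarith
  · rw [div_lt_iff₀ hpos]; nlinarith

/-- ★ **Contacts per irreducible piece drop from width two to width three**: `θ₃/ν₃ < θ₂/ν₂ = (5√2 − 1)/14 = 0.4336…` (#715 §8).
[cite: Feller1968, XIII.11; DuminilCopinHammond2013, §2.2; lane «pcv-sawmu» a-p2 g26 — own result, not in print] -/
theorem contacts_per_piece_three_lt_two : thetaThree / nuThree < (5 * Real.sqrt 2 - 1) / 14 := by
  obtain ⟨-, h⟩ := contacts_per_piece_three_window
  obtain ⟨hr, -⟩ := sqrt_two_window15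
  linarith

end W3

end HV

end Literature.Probability.RandomPlanarGeometry.SAW
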